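import Summits.CriticalPhenomena.CardyFormulaZ2.Theses.CardyComplexCone
import HarnessLib

/-!
# Item `TargetOfCruxes` of route `CardyComplexCone` (stmt-CriticalPhenomena-14119)

Glue to the route target: the two leading cruxes give `X = Target`, i.e.
`EdgeCoherence → EdgePrecompact → Target`.

`Target` is literally the conjunction of the bodies of `EdgeCoherence` (existence of a universal
class vector `u` aligning the four corner values of the spin-1/3 edge observable `E_δ` at leading
order `δ^{1/3}`) and `EdgePrecompact` (local `O(δ^{1/3})` bound and same-class equicontinuity of
`E_δ`), elaborated in the same context, so `Target ↔ EdgeCoherence ∧ EdgePrecompact` holds by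
`Iff.rfl` and the item is closed by `fun hC hP => ⟨hC, hP⟩`. No mathematical content; the deciding
theorem `closes` of the route consumes the two cruxes directly and is untouched.
-/

namespace Summit.CriticalPhenomena.CardyFormulaZ2.Theorems

open Summit.CriticalPhenomena.CardyFormulaZ2.Theses.CardyComplexCone in
/-- The route target `Target` of `CardyComplexCone` is, definitionally, the conjunction
`EdgeCoherence ∧ EdgePrecompact` of its two leading cruxes. -/
theorem cardyComplexCone_target_iff :
    Target ↔ EdgeCoherence ∧ EdgePrecompact :=
  Iff.rfl

/-- **Item `TargetOfCruxes` (stmt-CriticalPhenomena-14119), proved.** The two leading cruxes of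
route `CardyComplexCone` give its target: `EdgeCoherence → EdgePrecompact → Target` (pure logic,
`Target` being the conjunction of the two bodies). -/
theorem targetOfCruxes_proof :
    Summit.CriticalPhenomena.CardyFormulaZ2.Theses.CardyComplexCone.TargetOfCruxes := by
  unfold Summit.CriticalPhenomena.CardyFormulaZ2.Theses.CardyComplexCone.TargetOfCruxes
  exact fun hC hP => (cardyComplexCone_target_iff).2 ⟨hC, hP⟩

end Summit.CriticalPhenomena.CardyFormulaZ2.Theorems
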